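import Mathlib
import Summits.Ventures.PercRepro2.HCov
import Summits.Ventures.PercRepro2.BHKEvents
import Summits.Ventures.PercRepro2.FirstOrderTerms
import Summits.Ventures.PercRepro2.FirstOrderSlope

/-!
# The `b`-slope of the pendant-root form at the OWN centering `σ̄_b` is non-negative
(blind cell PercRepro2, p5 g22; `proofs/P5-OEDGE.md` §28)

With `Q = {a₁ ↮ a₂}`, `T = {a₁ ↮ a₂, a₃ ∈ C₂}`, `S_b = E[σ_b; Q] = P(Q, b ∈ C₁) − P(Q, b ∈ C₂)`:

* **`T_bH_mul_Q_ge`**: `P(T) · P(Q, b ∈ C₂) ≤ P(T, b ∈ C₂) · P(Q)` — BHK06 Thm 1.2 (`bhk_same_cluster_events`,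
  `s = a₂`, `t = a₁`, `𝓤 = {a₃ ∈ ·}`, `𝓥 = {b ∈ ·}`): two increasing events of `C₂` are positively
  correlated on `{a₂ ↮ a₁}`;
* **`T_sigma_mul_Q_le`**: `E[σ_b; T] · P(Q) ≤ P(T) · S_b`, i.e. `E[σ_b | T] ≤ E[σ_b | Q]` (the `b ∈ C₁` half
  is `bhk_cross_cluster_avoid` with `s = a₂`, `t = a₁`, `X = {a₁}`, `𝓤 = {a₃ ∈ ·}`, as in `FirstOrderSlopeG`);
* **`slopeGsbar_nonneg`**: `0 ≤ slopeGsbar := P(Q)·P(PD, b ∈ C₂) + P(T)·S_b − P(Q)·E[σ_b; T]`, the cleared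
  `g`-derivative `P(Q)·∂_gΨ(σ̄_b)` of the bilinear pendant-root form at the own centering
  (`∂_gΨ(s) = P(PD, b ∈ C₂) + E[s − σ_b; T]`); hence `Ψ(σ̄_b, g)` is non-decreasing in `g`: together with
  (HCOV) at the instance this gives `Ψ(σ̄_b, g) ≥ 0` for every `g ≥ γ` (`Psi_sbar_mono`).
-/

namespace Summit.Ventures.PercRepro2

open UnionCluster

namespace CovForm

namespace FirstOrder

section Main

variable {V : Type*} {E : Type*} [Fintype E] [DecidableEq E] [Fintype V] [DecidableEq V]
  {R : Type*} [Field R] [LinearOrder R] [IsStrictOrderedRing R]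

omit [Fintype E] [DecidableEq E] [Fintype V] [DecidableEq V] in
/-- `T ∩ {b ∈ C₂} = {a₃ ∈ C(a₂)} ∩ {b ∈ C(a₂)} ∩ {a₂ ↮ a₁}`. -/
lemma TEvent_inter_bH_eq (ends : E → Sym2 V) (a₁ a₂ a₃ b : V) :
    TEvent ends a₁ a₂ a₃ ∩ connEvent ends a₂ b =
      clusterInEvent ends a₂ {W | a₃ ∈ W} ∩ clusterInEvent ends a₂ {W | b ∈ W} ∩
        (connEvent ends a₂ a₁)ᶜ := by
  ext ω
  simp only [TEvent, Set.mem_inter_iff, Set.mem_compl_iff, mem_connEvent, mem_clusterInEvent,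
    Set.mem_setOf_eq, mem_cluster]
  tauto

omit [Fintype E] [DecidableEq E] [Fintype V] [DecidableEq V] in
/-- `T = {a₃ ∈ C(a₂)} ∩ {a₂ ↮ a₁}` (the form of `FirstOrderSlopeG.TEvent_eq_clusterIn_inter_avoid'`). -/
lemma TEvent_eq_clusterIn_a3_inter (ends : E → Sym2 V) (a₁ a₂ a₃ : V) :
    TEvent ends a₁ a₂ a₃ = clusterInEvent ends a₂ {W | a₃ ∈ W} ∩ avoidAll ends a₂ {a₁} := by
  ext ω
  simp only [TEvent, Set.mem_inter_iff, Set.mem_compl_iff, mem_connEvent, mem_clusterInEvent,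
    Set.mem_setOf_eq, mem_cluster, mem_avoidAll, Finset.mem_singleton, forall_eq]
  tauto

omit [Fintype E] [DecidableEq E] [Fintype V] [DecidableEq V] in
/-- `{a₂ ↮ a₁} = avoidAll a₂ {a₁}`. -/
lemma compl_connEvent_eq_avoidAll (ends : E → Sym2 V) (a₁ a₂ : V) :
    (connEvent ends a₂ a₁)ᶜ = avoidAll ends a₂ {a₁} := by
  ext ω
  simp only [Set.mem_compl_iff, mem_connEvent, mem_avoidAll, Finset.mem_singleton, forall_eq]

/-- **`P(T) · P(Q, b ∈ C₂) ≤ P(T, b ∈ C₂) · P(Q)`** (BHK06 Thm 1.2, `bhk_same_cluster_events`): on `Q`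
the increasing events `a₃ ∈ C₂` and `b ∈ C₂` of the cluster of `a₂` are positively correlated. -/
theorem T_bH_mul_Q_ge (p : E → R) (hp : IsProbVec p) (ends : E → Sym2 V) (a₁ a₂ a₃ b : V) :
    prob p (TEvent ends a₁ a₂ a₃) * prob p (avoidAll ends a₂ {a₁} ∩ connEvent ends a₂ b) ≤
      prob p (TEvent ends a₁ a₂ a₃ ∩ connEvent ends a₂ b) * prob p (avoidAll ends a₂ {a₁}) := by
  have h := bhk_same_cluster_events p hp ends a₂ a₁ (isUpperSet_mem_setOf a₃) (isUpperSet_mem_setOf b)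
  rw [TEvent_inter_bH_eq, TEvent_eq_clusterIn_a3_inter, compl_connEvent_eq_avoidAll,
    ← connEvent_eq_clusterInEvent ends a₂ b, Set.inter_comm (avoidAll ends a₂ {a₁}) (connEvent ends a₂ b)]
  rw [compl_connEvent_eq_avoidAll, ← connEvent_eq_clusterInEvent ends a₂ b] at h
  exact h

/-- **`E[σ_b; T] · P(Q) ≤ P(T) · E[σ_b; Q]`**: `E[σ_b | T] ≤ E[σ_b | Q] = σ̄_b` — the `b ∈ C₁` half by
`T_clusterIn_mul_Q_le`, the `b ∈ C₂` half by `T_bH_mul_Q_ge`. -/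
theorem T_sigma_mul_Q_le (p : E → R) (hp : IsProbVec p) (ends : E → Sym2 V) (a₁ a₂ a₃ b : V) :
    (prob p (TEvent ends a₁ a₂ a₃ ∩ connEvent ends a₁ b) -
        prob p (TEvent ends a₁ a₂ a₃ ∩ connEvent ends a₂ b)) * prob p (avoidAll ends a₂ {a₁}) ≤
      prob p (TEvent ends a₁ a₂ a₃) *
        (prob p (avoidAll ends a₂ {a₁} ∩ connEvent ends a₁ b) -
          prob p (avoidAll ends a₂ {a₁} ∩ connEvent ends a₂ b)) := by
  -- the `b ∈ C₁` half: `bhk_cross_cluster_avoid` with `s = a₂`, `t = a₁`, `X = {a₁}`, `𝓤 = {a₃ ∈ ·}`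
  have h1 : prob p (TEvent ends a₁ a₂ a₃ ∩ connEvent ends a₁ b) * prob p (avoidAll ends a₂ {a₁}) ≤
      prob p (TEvent ends a₁ a₂ a₃) * prob p (avoidAll ends a₂ {a₁} ∩ connEvent ends a₁ b) := by
    have h := bhk_cross_cluster_avoid p hp ends a₂ a₁ (Finset.mem_singleton_self a₁)
      (isUpperSet_mem_setOf a₃) (isUpperSet_mem_setOf b)
    have e : TEvent ends a₁ a₂ a₃ ∩ connEvent ends a₁ b =
        clusterInEvent ends a₂ {W | a₃ ∈ W} ∩ clusterInEvent ends a₁ {W | b ∈ W} ∩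
          avoidAll ends a₂ {a₁} := by
      ext ω
      simp only [TEvent, Set.mem_inter_iff, Set.mem_compl_iff, mem_connEvent, mem_clusterInEvent,
        Set.mem_setOf_eq, mem_cluster, mem_avoidAll, Finset.mem_singleton, forall_eq]
      tauto
    rw [e, TEvent_eq_clusterIn_a3_inter, Set.inter_comm (avoidAll ends a₂ {a₁}) (connEvent ends a₁ b)]
    rw [← connEvent_eq_clusterInEvent ends a₁ b] at h
    exact h
  have h2 := T_bH_mul_Q_ge p hp ends a₁ a₂ a₃ b
  linarith

/-- **The cleared `b`-slope of the pendant-root form at the own centering**: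
`slopeGsbar = P(Q)·P(PD, b ∈ C₂) + P(T)·S_b − P(Q)·E[σ_b; T]` (`= P(Q)·∂_gΨ(σ̄_b)`). -/
noncomputable def slopeGsbar (p : E → R) (ends : E → Sym2 V) (a₁ a₂ a₃ b : V) : R :=
  prob p (avoidAll ends a₂ {a₁}) * prob p (PDEvent ends a₁ a₂ a₃ ∩ connEvent ends a₂ b) +
    prob p (TEvent ends a₁ a₂ a₃) *
      (prob p (avoidAll ends a₂ {a₁} ∩ connEvent ends a₁ b) -
        prob p (avoidAll ends a₂ {a₁} ∩ connEvent ends a₂ b)) -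
    prob p (avoidAll ends a₂ {a₁}) *
      (prob p (TEvent ends a₁ a₂ a₃ ∩ connEvent ends a₁ b) -
        prob p (TEvent ends a₁ a₂ a₃ ∩ connEvent ends a₂ b))

/-- **`0 ≤ slopeGsbar`**: the `b`-slope `∂_gΨ(σ̄_b)` at the own centering is non-negative. -/
theorem slopeGsbar_nonneg (p : E → R) (hp : IsProbVec p) (ends : E → Sym2 V) (a₁ a₂ a₃ b : V) :
    0 ≤ slopeGsbar p ends a₁ a₂ a₃ b := by
  unfold slopeGsbar
  have h := T_sigma_mul_Q_le p hp ends a₁ a₂ a₃ b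
  have hQ : 0 ≤ prob p (avoidAll ends a₂ {a₁}) := prob_nonneg hp _
  have hPD : 0 ≤ prob p (PDEvent ends a₁ a₂ a₃ ∩ connEvent ends a₂ b) := prob_nonneg hp _
  nlinarith [mul_nonneg hQ hPD]

end Main

end FirstOrder

end CovForm

end Summit.Ventures.PercRepro2
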